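import Literature.NumberTheory.ModularForms.BinaryQuadGaussSumParseval
import HarnessLib

/-!
# Gauss sums of binary quadratic forms, V: `|G(a, c; f, 0)| = c·√(c, D)` for every modulus `c`

Topic `NumberTheory/ModularForms` (namespace `Literature.NumberTheory.ModularForms`), continuing
`BinaryQuadGaussSumLattice.lean` and `BinaryQuadGaussSumParseval.lean`. Everything here is PROVED;
no definition, no named fact. For a form `f = (A,B,C)` with `4AC − B² = r·s`, `s` squarefree,
`(r, s) = 1`, odd discriminant, Gram matrix `M = (2A B; B 2C)`:

* `card_gram_ker_eq_self` — `#{h ∈ (ℤ/s)² : M h = 0} = s`, WITHOUT local (`p`-adic / rank)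
  arguments: Parseval `Σ_w |G(1,s;f,w)|² = s⁴`, the support/phase structure of the twisted sums
  (`|G(1,s;f,w)| = |G(1,s;f,0)|·[adj(M)w = 0]`), `|G(1,s;f,0)|² = s²·#ker M` and
  `#ker adj(M) = #ker M` give `(#ker M)²·s² = s⁴`.
* `card_gram_ker_eq_of_mul` — for `c = t·s` with `(r, t) = 1`: `#{h ∈ (ℤ/c)² : Mh = 0} =
  #{v ∈ (ℤ/s)² : Mv = 0}` (`v ↦ t·v`; surjectivity: `c ∣ Mh ⇒ c ∣ (4AC − B²)h = rs·h ⇒ t ∣ h`).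
* `norm_binQuadGaussSum_zero_zero_eq` — **`|G(a, c; f, 0)| = c·√s`** for every unit `a` and
  every such `c` (even or odd; no condition `(A, c) = 1`), complementing the odd-`c` evaluation
  `BinaryQuadGaussSumValues.norm_binQuadGaussSum_zero_zero`;
* `norm_binQuadGaussSum_zero_zero_cusp`, `norm_cusp_eta_eq_one` — the cusp form: `q` squarefree,
  `disc f = −q`, `a ā ≡ 1 (mod c)` ⇒ `|G(a,c;f,0)| = c·√(c,q)` and `|−i·G(a,c;f,0)/(c√(c,q))| = 1` —
  the `|η| = 1` of Conrey–Iwaniec (2.30)/(3.15)/(3.17) for the pseudo-eigenvalue of `θ_f` at the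
  cusp `a/c` (`Automorphic/BinaryThetaCuspTransform.binaryTheta_cusp_omega_relation`).

## References

* A. N. Andrianov, V. G. Zhuravlev, *Modular Forms and Hecke Operators*, AMS (1995/2015), Ch. 1
  §4.4 Proposition 4.9, §4.5 Lemma 4.13 (moduli of Gauss sums of quadratic forms)
  [AndrianovZhuravlev2015].
* B. Conrey, H. Iwaniec, Acta Arith. 103 (2002) 259–312, §2 (2.30), §3 (3.15), (3.17): `|η| = 1`
  [ConreyIwaniec2002].
-/

noncomputable section

open Complex Finset

namespace Literature.NumberTheory.ModularForms

open Literature.NumberTheory.QuadraticFields.Quadratic (BinQF)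
open Literature.NumberTheory.LFunctions (norm_stdAddChar)

/-! ### The kernel count at level `s` by Parseval -/

/-- At level `s` (`4AC − B² = r s`, `s` squarefree, `(r,s) = 1`): the twisted sum with
numerator `1` has `|G(1, s; f, w)|² = |G(1, s; f, 0)|²` if `adj(M)w = 0` in `(ℤ/s)²` and `= 0`
otherwise (`BinaryQuadGaussSumLattice`). [cite: AndrianovZhuravlev2015, Ch. 1 §4.3 (4.13)–(4.14)] -/
theorem norm_sq_binQuadGaussSum_one_eq_ite (f : BinQF) {r : ℤ} {s : ℕ} [NeZero s]
    (hsq : Squarefree s) (hrs : 4 * f.a * f.c - f.b ^ 2 = r * s) (hcop : IsCoprime r (s : ℤ))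
    (w : ZMod s × ZMod s) :
    ‖binQuadGaussSum s f 1 w.1 w.2‖ ^ 2 =
      if 2 * (f.c : ZMod s) * w.1 - (f.b : ZMod s) * w.2 = 0 ∧
          -(f.b : ZMod s) * w.1 + 2 * (f.a : ZMod s) * w.2 = 0 then
        ‖binQuadGaussSum s f 1 0 0‖ ^ 2 else 0 := by
  have hs0 : s ≠ 0 := NeZero.ne s
  -- integer lifts of `w`
  set w₁ : ℤ := (w.1.val : ℤ) with hw₁
  set w₂ : ℤ := (w.2.val : ℤ) with hw₂
  have e1 : (w₁ : ZMod s) = w.1 := by rw [hw₁, Int.cast_natCast, ZMod.natCast_zmod_val]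
  have e2 : (w₂ : ZMod s) = w.2 := by rw [hw₂, Int.cast_natCast, ZMod.natCast_zmod_val]
  have hcond1 : (s : ℤ) ∣ 2 * f.c * w₁ - f.b * w₂ ↔
      2 * (f.c : ZMod s) * w.1 - (f.b : ZMod s) * w.2 = 0 := by
    rw [← ZMod.intCast_zmod_eq_zero_iff_dvd]; push_cast; rw [e1, e2]
  have hcond2 : (s : ℤ) ∣ -f.b * w₁ + 2 * f.a * w₂ ↔
      -(f.b : ZMod s) * w.1 + 2 * (f.a : ZMod s) * w.2 = 0 := by
    rw [← ZMod.intCast_zmod_eq_zero_iff_dvd]; push_cast; rw [e1, e2]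
  have hsD : (s : ℤ) ∣ f.disc := ⟨-r, by rw [BinQF.disc]; linear_combination -hrs⟩
  -- `r` is a unit mod `s`
  have hru : IsUnit ((r : ℤ) : ZMod s) := by
    obtain ⟨u, v, huv⟩ := hcop
    refine IsUnit.of_mul_eq_one (u : ZMod s) ?_
    have h := congrArg (Int.cast (R := ZMod s)) huv
    push_cast at h
    rw [ZMod.natCast_self, mul_zero, add_zero] at h
    rw [mul_comm]; exact h
  have hrr : ((r : ℤ) : ZMod s) * ((r : ℤ) : ZMod s)⁻¹ = 1 := ZMod.mul_inv_of_unit _ hru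
  rw [show binQuadGaussSum s f 1 w.1 w.2 = binQuadGaussSum s f 1 (w₁ : ZMod s) (w₂ : ZMod s) by
    rw [e1, e2]]
  by_cases hw : (s : ℤ) ∣ 2 * f.c * w₁ - f.b * w₂ ∧ (s : ℤ) ∣ -f.b * w₁ + 2 * f.a * w₂
  · rw [if_pos ⟨hcond1.mp hw.1, hcond2.mp hw.2⟩,
      binQuadGaussSum_eq_of_dvd_adj' f hs0 hrs hcop 1 1 (((r : ℤ) : ZMod s)⁻¹) (one_mul 1) hrr
        w₁ w₂ hw.1 hw.2, norm_mul, norm_stdAddChar, one_mul]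
  · rw [if_neg (fun h ↦ hw ⟨hcond1.mpr h.1, hcond2.mpr h.2⟩),
      binQuadGaussSum_eq_zero_of_not_dvd_adj f hsq (dvd_refl s) hsD 1 w₁ w₂ hw, norm_zero,
      zero_pow two_ne_zero]

/-- **The kernel of the Gram matrix mod `s` has exactly `s` elements** (`4AC − B² = r·s`, `s`
squarefree, `(r, s) = 1`, odd discriminant): `#{h ∈ (ℤ/s)² : 2Ah₁ + Bh₂ = Bh₁ + 2Ch₂ = 0} = s`.
Global proof: Parseval `Σ_w |G(1,s;f,w)|² = s⁴`, `|G(1,s;f,w)|² = |G(1,s;f,0)|²·[adj(M)w = 0]`,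
`|G(1,s;f,0)|² = s²·#ker M`, `#ker adj M = #ker M`, so `(#ker M)²s² = s⁴`. (Locally: `M mod p` has
rank one for each `p ∣ s`.) [cite: AndrianovZhuravlev2015, Ch. 1 §4.5 Lemma 4.13] -/
theorem card_gram_ker_eq_self (f : BinQF) {r : ℤ} {s : ℕ} [NeZero s] (hsq : Squarefree s)
    (hrs : 4 * f.a * f.c - f.b ^ 2 = r * s) (hcop : IsCoprime r (s : ℤ)) (hodd : Odd f.disc) :
    (Finset.univ.filter fun h : ZMod s × ZMod s ↦
        2 * (f.a : ZMod s) * h.1 + (f.b : ZMod s) * h.2 = 0 ∧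
          (f.b : ZMod s) * h.1 + 2 * (f.c : ZMod s) * h.2 = 0).card = s := by
  classical
  set n := (Finset.univ.filter fun h : ZMod s × ZMod s ↦
        2 * (f.a : ZMod s) * h.1 + (f.b : ZMod s) * h.2 = 0 ∧
          (f.b : ZMod s) * h.1 + 2 * (f.c : ZMod s) * h.2 = 0).card with hn
  have hP := sum_norm_sq_binQuadGaussSum (c := s) f 1
  simp_rw [norm_sq_binQuadGaussSum_one_eq_ite f hsq hrs hcop] at hP
  rw [Finset.sum_ite, Finset.sum_const_zero, add_zero, Finset.sum_const, nsmul_eq_mul,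
    card_adj_ker_eq_card_gram_ker (c := s) f,
    norm_sq_binQuadGaussSum_zero_zero_eq_card (c := s) f hodd isUnit_one] at hP
  -- `n * (s² * n) = s⁴` in `ℕ`
  rw [← hn] at hP
  have hP' : n * (s ^ 2 * n) = s ^ 4 := by exact_mod_cast hP
  have hsq' : (n * s) ^ 2 = (s * s) ^ 2 := by
    calc (n * s) ^ 2 = n * (s ^ 2 * n) := by ring
      _ = s ^ 4 := hP'
      _ = (s * s) ^ 2 := by ring
  have h1 : n * s = s * s := Nat.pow_left_injective (by norm_num) hsq'
  exact Nat.eq_of_mul_eq_mul_right (Nat.pos_of_ne_zero (NeZero.ne s)) h1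

/-! ### Transfer of the kernel from level `c = t·s` to level `s` -/

/-- `(4AC − B²)·h₁ = 2C·(2Ah₁ + Bh₂) − B·(Bh₁ + 2Ch₂)`. [folklore] -/
private theorem adj_mul_gram_fst (A B C h₁ h₂ : ℤ) :
    (4 * A * C - B ^ 2) * h₁ = 2 * C * (2 * A * h₁ + B * h₂) - B * (B * h₁ + 2 * C * h₂) := by ring

/-- `(4AC − B²)·h₂ = −B·(2Ah₁ + Bh₂) + 2A·(Bh₁ + 2Ch₂)`. [folklore] -/
private theorem adj_mul_gram_snd (A B C h₁ h₂ : ℤ) :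
    (4 * A * C - B ^ 2) * h₂ = -B * (2 * A * h₁ + B * h₂) + 2 * A * (B * h₁ + 2 * C * h₂) := by ring

/-- **The kernel of the Gram matrix mod `c = t·s` is in bijection with the kernel mod `s`** when
`4AC − B² = r·s` and `(r, t) = 1`: `v ↦ t·v` maps `{v ∈ (ℤ/s)² : Mv = 0}` bijectively onto
`{h ∈ (ℤ/c)² : Mh = 0}` (surjectivity: `c ∣ Mh ⇒ c ∣ adj(M)Mh = rs·h ⇒ t ∣ r·h ⇒ t ∣ h`).
[cite: AndrianovZhuravlev2015, Ch. 1 §4.5 Lemma 4.13] -/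
theorem card_gram_ker_eq_of_mul (f : BinQF) {c s t : ℕ} [NeZero c] [NeZero s] (hc : c = t * s)
    {r : ℤ} (hrs : 4 * f.a * f.c - f.b ^ 2 = r * s) (hcop : IsCoprime r (t : ℤ)) :
    (Finset.univ.filter fun h : ZMod c × ZMod c ↦
        2 * (f.a : ZMod c) * h.1 + (f.b : ZMod c) * h.2 = 0 ∧
          (f.b : ZMod c) * h.1 + 2 * (f.c : ZMod c) * h.2 = 0).card =
      (Finset.univ.filter fun v : ZMod s × ZMod s ↦
        2 * (f.a : ZMod s) * v.1 + (f.b : ZMod s) * v.2 = 0 ∧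
          (f.b : ZMod s) * v.1 + 2 * (f.c : ZMod s) * v.2 = 0).card := by
  classical
  have ht0 : t ≠ 0 := by rintro rfl; exact NeZero.ne c (by rw [hc, zero_mul])
  have ht0' : (t : ℤ) ≠ 0 := Int.natCast_ne_zero.mpr ht0
  have hcZ : (c : ℤ) = t * s := by exact_mod_cast hc
  -- divisibility by `c = t s` of `t·X` from divisibility of `X` by `s`, and conversely
  have hdvd_iff : ∀ X : ℤ, (c : ℤ) ∣ t * X ↔ (s : ℤ) ∣ X := by
    intro X; rw [hcZ]; exact mul_dvd_mul_iff_left ht0'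
  symm
  refine Finset.card_bij
    (fun (v : ZMod s × ZMod s) _ ↦
      (((((t : ℤ) * (v.1.val : ℤ) : ℤ)) : ZMod c), ((((t : ℤ) * (v.2.val : ℤ) : ℤ)) : ZMod c)))
    (fun v hv ↦ ?_) (fun v hv v' hv' hvv' ↦ ?_) (fun h hh ↦ ?_)
  · -- maps into the kernel mod `c`
    rw [Finset.mem_filter] at hv ⊢
    obtain ⟨-, hv1, hv2⟩ := hv
    have e1 : ((v.1.val : ℕ) : ZMod s) = v.1 := ZMod.natCast_zmod_val v.1
    have e2 : ((v.2.val : ℕ) : ZMod s) = v.2 := ZMod.natCast_zmod_val v.2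
    have d1 : (s : ℤ) ∣ 2 * f.a * v.1.val + f.b * v.2.val := by
      rw [← ZMod.intCast_zmod_eq_zero_iff_dvd]; push_cast; rw [e1, e2]; exact hv1
    have d2 : (s : ℤ) ∣ f.b * v.1.val + 2 * f.c * v.2.val := by
      rw [← ZMod.intCast_zmod_eq_zero_iff_dvd]; push_cast; rw [e1, e2]; exact hv2
    refine ⟨Finset.mem_univ _, ?_, ?_⟩
    · have h := (ZMod.intCast_zmod_eq_zero_iff_dvd _ c).mpr ((hdvd_iff _).mpr d1)
      push_cast at h ⊢
      linear_combination h
    · have h := (ZMod.intCast_zmod_eq_zero_iff_dvd _ c).mpr ((hdvd_iff _).mpr d2)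
      push_cast at h ⊢
      linear_combination h
  · -- injective
    simp only [Prod.mk.injEq] at hvv'
    obtain ⟨h1, h2⟩ := hvv'
    have k1 := (ZMod.intCast_eq_intCast_iff_dvd_sub _ _ c).mp h1
    have k2 := (ZMod.intCast_eq_intCast_iff_dvd_sub _ _ c).mp h2
    rw [← mul_sub, hdvd_iff] at k1 k2
    have j1 := (ZMod.intCast_eq_intCast_iff_dvd_sub _ _ s).mpr k1
    have j2 := (ZMod.intCast_eq_intCast_iff_dvd_sub _ _ s).mpr k2
    simp only [Int.cast_natCast, ZMod.natCast_zmod_val] at j1 j2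
    exact Prod.ext j1 j2
  · -- surjective
    rw [Finset.mem_filter] at hh
    obtain ⟨-, hh1, hh2⟩ := hh
    set x₁ : ℤ := (h.1.val : ℤ) with hx₁
    set x₂ : ℤ := (h.2.val : ℤ) with hx₂
    have e1 : (x₁ : ZMod c) = h.1 := by rw [hx₁, Int.cast_natCast, ZMod.natCast_zmod_val]
    have e2 : (x₂ : ZMod c) = h.2 := by rw [hx₂, Int.cast_natCast, ZMod.natCast_zmod_val]
    have dY1 : (c : ℤ) ∣ 2 * f.a * x₁ + f.b * x₂ := by
      rw [← ZMod.intCast_zmod_eq_zero_iff_dvd]; push_cast; rw [e1, e2]; exact hh1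
    have dY2 : (c : ℤ) ∣ f.b * x₁ + 2 * f.c * x₂ := by
      rw [← ZMod.intCast_zmod_eq_zero_iff_dvd]; push_cast; rw [e1, e2]; exact hh2
    -- `c ∣ (4AC − B²) xᵢ = r s xᵢ`, hence `t ∣ r xᵢ`, hence `t ∣ xᵢ`
    have dq1 : (c : ℤ) ∣ (4 * f.a * f.c - f.b ^ 2) * x₁ := by
      rw [adj_mul_gram_fst]; exact (dY1.mul_left _).sub (dY2.mul_left _)
    have dq2 : (c : ℤ) ∣ (4 * f.a * f.c - f.b ^ 2) * x₂ := by
      rw [adj_mul_gram_snd]; exact (dY1.mul_left _).add (dY2.mul_left _)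
    rw [hrs] at dq1 dq2
    have dt1 : (t : ℤ) ∣ x₁ := by
      have : (t : ℤ) ∣ r * x₁ := by
        rw [show r * (s : ℤ) * x₁ = s * (r * x₁) by ring, hcZ, mul_comm (t : ℤ)] at dq1
        exact (mul_dvd_mul_iff_left (Int.natCast_ne_zero.mpr (NeZero.ne s))).mp dq1
      exact hcop.symm.dvd_of_dvd_mul_left this
    have dt2 : (t : ℤ) ∣ x₂ := by
      have : (t : ℤ) ∣ r * x₂ := by
        rw [show r * (s : ℤ) * x₂ = s * (r * x₂) by ring, hcZ, mul_comm (t : ℤ)] at dq2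
        exact (mul_dvd_mul_iff_left (Int.natCast_ne_zero.mpr (NeZero.ne s))).mp dq2
      exact hcop.symm.dvd_of_dvd_mul_left this
    obtain ⟨u₁, hu₁⟩ := dt1
    obtain ⟨u₂, hu₂⟩ := dt2
    refine ⟨((u₁ : ZMod s), (u₂ : ZMod s)), ?_, ?_⟩
    · rw [Finset.mem_filter]
      refine ⟨Finset.mem_univ _, ?_, ?_⟩
      · have d : (s : ℤ) ∣ 2 * f.a * u₁ + f.b * u₂ := by
          rw [← hdvd_iff]; rw [hu₁, hu₂] at dY1
          rw [show (t : ℤ) * (2 * f.a * u₁ + f.b * u₂) = 2 * f.a * (t * u₁) + f.b * (t * u₂) by ring]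
          exact dY1
        have := (ZMod.intCast_zmod_eq_zero_iff_dvd _ s).mpr d
        push_cast at this; exact this
      · have d : (s : ℤ) ∣ f.b * u₁ + 2 * f.c * u₂ := by
          rw [← hdvd_iff]; rw [hu₁, hu₂] at dY2
          rw [show (t : ℤ) * (f.b * u₁ + 2 * f.c * u₂) = f.b * (t * u₁) + 2 * f.c * (t * u₂) by ring]
          exact dY2
        have := (ZMod.intCast_zmod_eq_zero_iff_dvd _ s).mpr d
        push_cast at this; exact this
    · -- the image is `h`
      have k1 : (((t : ℤ) * (((u₁ : ZMod s)).val : ℤ) : ℤ) : ZMod c) = (x₁ : ZMod c) := by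
        rw [ZMod.intCast_eq_intCast_iff_dvd_sub, hu₁, ← mul_sub, hdvd_iff,
          ← ZMod.intCast_eq_intCast_iff_dvd_sub]
        simp
      have k2 : (((t : ℤ) * (((u₂ : ZMod s)).val : ℤ) : ℤ) : ZMod c) = (x₂ : ZMod c) := by
        rw [ZMod.intCast_eq_intCast_iff_dvd_sub, hu₂, ← mul_sub, hdvd_iff,
          ← ZMod.intCast_eq_intCast_iff_dvd_sub]
        simp
      exact Prod.ext (k1.trans e1) (k2.trans e2)

/-! ### The modulus of the untwisted sum -/

/-- **`|G(a, c; f, 0)| = c·√s` for EVERY modulus `c`** (even or odd, no condition `(A,c) = 1`):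
`c = t·s`, `4AC − B² = r·s`, `s` squarefree, `(r, s) = (r, t) = 1`, `D` odd, `a` a unit mod `c`
(so in particular `s = (c, 4AC − B²)`). From `|G|² = c²·#ker_c M = c²·#ker_s M = c²·s`.
(The odd-`c` case via one-variable Gauss sums, with the same value, is
`BinaryQuadGaussSumValues.norm_binQuadGaussSum_zero_zero`.) [cite: AndrianovZhuravlev2015, Ch. 1 §4.4 Proposition 4.9, §4.5 Lemma 4.13] -/
theorem norm_binQuadGaussSum_zero_zero_eq (f : BinQF) {c s t : ℕ} [NeZero c] [NeZero s]
    (hc : c = t * s) (hsq : Squarefree s) {r : ℤ} (hrs : 4 * f.a * f.c - f.b ^ 2 = r * s)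
    (hcops : IsCoprime r (s : ℤ)) (hcopt : IsCoprime r (t : ℤ)) (hodd : Odd f.disc)
    {a : ZMod c} (ha : IsUnit a) :
    ‖binQuadGaussSum c f a 0 0‖ = c * Real.sqrt s := by
  have h2 : ‖binQuadGaussSum c f a 0 0‖ ^ 2 = ((c : ℝ) * Real.sqrt s) ^ 2 := by
    rw [norm_sq_binQuadGaussSum_zero_zero_eq_card f hodd ha, card_gram_ker_eq_of_mul f hc hrs hcopt,
      card_gram_ker_eq_self f hsq hrs hcops hodd, mul_pow, Real.sq_sqrt (Nat.cast_nonneg _)]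
  exact (pow_left_inj₀ (norm_nonneg _) (by positivity) two_ne_zero).mp h2

/-! ### The cusp datum `s = (c, q)` for squarefree `q` -/

/-- For squarefree `n` and `d ∣ n`: `(n/d, d) = 1`. [folklore] -/
private theorem coprime_div_of_squarefree' {n d : ℕ} (hn : Squarefree n) (hd : d ∣ n) :
    Nat.Coprime (n / d) d := by
  set g := Nat.gcd (n / d) d with hg
  have h3 : g * g ∣ n := by
    rw [← Nat.div_mul_cancel hd]
    exact Nat.mul_dvd_mul (Nat.gcd_dvd_left _ _) (Nat.gcd_dvd_right _ _)
  exact Nat.isUnit_iff.mp (hn g h3)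

/-- The discriminant of a form with `disc f = −q`, `q` squarefree, is odd (`q` even would force
`B` even and `4 ∣ q`). [cite: ConreyIwaniec2002, §2 (2.19)] -/
theorem odd_disc_of_squarefree (f : BinQF) {q : ℕ} (hq : Squarefree q) (hdisc : f.disc = -(q : ℤ)) :
    Odd f.disc := by
  rw [← Int.not_even_iff_odd]
  intro hev
  have hB : Even f.b := by
    have : Even (f.b ^ 2) := by
      rw [BinQF.disc] at hev
      have : f.b ^ 2 = (f.b ^ 2 - 4 * f.a * f.c) + 2 * (2 * f.a * f.c) := by ring
      rw [this]; exact hev.add (even_two_mul _)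
    exact (Int.even_pow' two_ne_zero).mp this
  obtain ⟨k, hk⟩ := hB
  have h4 : (4 : ℤ) ∣ (q : ℤ) := ⟨-(k ^ 2 - f.a * f.c), by
    have := hdisc; rw [BinQF.disc, hk] at this; linear_combination this⟩
  have h4' : 2 * 2 ∣ q := by exact_mod_cast h4
  have := Nat.isUnit_iff.mp (hq 2 h4')
  norm_num at this

/-- **The cusp form of the modulus**: for `q` squarefree, `disc f = −q`, any `c ≥ 1` and
`a ā ≡ 1 (mod c)`: `|G(a, c; f, 0)| = c·√(c, q)`.
[cite: ConreyIwaniec2002, §3 (3.15), (3.17)] -/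
theorem norm_binQuadGaussSum_zero_zero_cusp (f : BinQF) {q : ℕ} (hq : Squarefree q)
    (hdisc : f.disc = -(q : ℤ)) (c : ℕ) [NeZero c] (a abar : ℤ) (hab : a * abar ≡ 1 [ZMOD c]) :
    ‖binQuadGaussSum c f (a : ZMod c) 0 0‖ = c * Real.sqrt (c.gcd q : ℕ) := by
  have hc : 0 < c := Nat.pos_of_ne_zero (NeZero.ne c)
  set s : ℕ := c.gcd q with hs
  haveI : NeZero s := ⟨(Nat.gcd_pos_of_pos_left q hc).ne'⟩
  have hsq : s ∣ q := Nat.gcd_dvd_right c q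
  have hsc : s ∣ c := Nat.gcd_dvd_left c q
  have hct : c = c / s * s := (Nat.div_mul_cancel hsc).symm
  have hqrs : q = q / s * s := (Nat.div_mul_cancel hsq).symm
  have hrs : 4 * f.a * f.c - f.b ^ 2 = ((q / s : ℕ) : ℤ) * s := by
    have h4 : (4 * f.a * f.c - f.b ^ 2 : ℤ) = (q : ℤ) := by rw [BinQF.disc] at hdisc; linarith
    rw [h4]; exact_mod_cast hqrs
  have hcops : IsCoprime ((q / s : ℕ) : ℤ) (s : ℤ) :=
    Nat.isCoprime_iff_coprime.mpr (coprime_div_of_squarefree' hq hsq)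
  -- `(q/s, c/s) = 1`: a common prime would divide `s` and then `p² ∣ q`
  have hcopt : IsCoprime ((q / s : ℕ) : ℤ) ((c / s : ℕ) : ℤ) := by
    rw [Nat.isCoprime_iff_coprime]
    have hr : q / s ∣ q := Nat.div_dvd_of_dvd hsq
    have h1 : Nat.gcd (q / s) (c / s) ∣ s :=
      Nat.dvd_gcd ((Nat.gcd_dvd_right _ _).trans (Nat.div_dvd_of_dvd hsc))
        ((Nat.gcd_dvd_left _ _).trans hr)
    have h2 : Nat.gcd (q / s) (c / s) ∣ Nat.gcd (q / s) s := Nat.dvd_gcd (Nat.gcd_dvd_left _ _) h1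
    rw [coprime_div_of_squarefree' hq hsq] at h2
    exact Nat.eq_one_of_dvd_one h2
  have ha : IsUnit (a : ZMod c) := by
    refine IsUnit.of_mul_eq_one (abar : ZMod c) ?_
    have := (ZMod.intCast_eq_intCast_iff _ _ c).mpr hab
    push_cast at this
    exact this
  exact norm_binQuadGaussSum_zero_zero_eq f hct (hq.squarefree_of_dvd hsq) hrs hcops hcopt
    (odd_disc_of_squarefree f hq hdisc) ha

/-- **`|η| = 1` for the pseudo-eigenvalue of `θ_f` at the cusp `a/c`**: with
`η_f = −i·G(a, c; f, 0)/(c·√(c,q))` (`binaryTheta_cusp_omega_relation`), `‖η_f‖ = 1`.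
[cite: ConreyIwaniec2002, §2 (2.30); §3 (3.15), (3.17)] -/
theorem norm_cusp_eta_eq_one (f : BinQF) {q : ℕ} (hq : Squarefree q) (hdisc : f.disc = -(q : ℤ))
    (c : ℕ) [NeZero c] (a abar : ℤ) (hab : a * abar ≡ 1 [ZMOD c]) :
    ‖-I * binQuadGaussSum c f (a : ZMod c) 0 0 / (((c : ℝ) * Real.sqrt (c.gcd q : ℕ) : ℝ) : ℂ)‖ = 1 := by
  have hc : 0 < c := Nat.pos_of_ne_zero (NeZero.ne c)
  have hs : 0 < Real.sqrt (c.gcd q : ℕ) :=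
    Real.sqrt_pos.mpr (by exact_mod_cast Nat.gcd_pos_of_pos_left q hc)
  have hpos : 0 < (c : ℝ) * Real.sqrt (c.gcd q : ℕ) := by positivity
  rw [norm_div, norm_mul, norm_neg, Complex.norm_I, one_mul,
    norm_binQuadGaussSum_zero_zero_cusp f hq hdisc c a abar hab, Complex.norm_real,
    Real.norm_of_nonneg hpos.le, div_self hpos.ne']

end Literature.NumberTheory.ModularForms

end
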